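import Mathlib
import HarnessLib
import Literature.NumberTheory.LFunctions.ZetaScrew
import Summits.RiemannHypothesis.RiemannHypothesis.Theorems.IntegerScrewIncrementCovLag
import Summits.RiemannHypothesis.RiemannHypothesis.Theorems.IntegerScrewIncrementBrackets
import Summits.RiemannHypothesis.RiemannHypothesis.Theorems.IntegerScrewHingeBrackets
import Summits.RiemannHypothesis.RiemannHypothesis.Theorems.IntegerScrewFarBrackets

/-!
# Route `IntegerScrew` — the Gram entries of the JOINT predictor (neighbours + hinge carriers), in label
# form: rows, diagonals, and bounded cross terms (PIVOT-LAW §15.14, kernel road (3)–(4); RH-FREE)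

The joint arithmetic floor (`IntegerScrewArithmeticFloor`) uses the trial vector built from the increments
with labels `M − k` (`0 ≤ k ≤ K`, the corner and its neighbours) and `⌈M/n⌉ = (M + n − 1)/n` (`n` in a finite
set of integers `≥ 2`, the hinge carriers).  With the bracket of two labels `x, y` written as
`B(x,y) = Ψ(log x − log(y−1)) + Ψ(log(x−1) − log y) − Ψ(log x − log y) − Ψ(log(x−1) − log(y−1))`
(the form produced by `IntegerScrewIncrementGram.screwPivot_le_incrementGram`), this file collects, as
`M → ∞` through ALL integers:

* `bracket_symm`, `bracket_eq_quot`, `bracket_self` — symmetry, the quotient form, the diagonal `2Ψ(h)`;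
* rows: `tendsto_cornerBracket_lag` (`M·B(M, M−k) → c_k/2`, `IntegerScrewIncrementCovLag`),
  `tendsto_cornerBracket_ceil` (`M·B(M, ⌈M/n⌉) → −Λ(n)/√n`, `IntegerScrewHingeBrackets`);
* diagonals: `tendsto_lagBracket_self_div_log` (`→ 1`), `tendsto_ceilBracket_self_div_log` (`→ n`);
* cross terms, eventually bounded: `eventually_abs_lagBracket_le` (two neighbours,
  `IntegerScrewIncrementBrackets`), `eventually_abs_lagCeilBracket_le` (neighbour vs carrier) and
  `eventually_abs_ceilCeilBracket_le` (two carriers) — both from `IntegerScrewFarBrackets`;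
* the label asymptotics `tendsto_natSub_div` (`(M−k)/M → 1`), `tendsto_ceilDiv_div` (`⌈M/n⌉/M → 1/n`).

Elementary; nothing here bears on the truth of RH. [Suzuki2023, (1.1)]
-/

noncomputable section

-- D-0017: `Summit.<S>.<S>.…` is the designed namespace of a single-problem summit.
set_option linter.dupNamespace false

namespace Summit.RiemannHypothesis.RiemannHypothesis.Theorems.IntegerScrew

open Literature.NumberTheory.LFunctions Filter Finset
open scoped Topology

/-! ### The bracket of two labels: symmetry, quotient form, diagonal -/

/-- The label bracket is symmetric (`Ψ` is even). [folklore] -/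
theorem bracket_symm (x y : ℝ) :
    zetaScrew (Real.log x - Real.log (y - 1)) + zetaScrew (Real.log (x - 1) - Real.log y)
      - zetaScrew (Real.log x - Real.log y) - zetaScrew (Real.log (x - 1) - Real.log (y - 1))
    = zetaScrew (Real.log y - Real.log (x - 1)) + zetaScrew (Real.log (y - 1) - Real.log x)
      - zetaScrew (Real.log y - Real.log x) - zetaScrew (Real.log (y - 1) - Real.log (x - 1)) := by
  rw [← zetaScrew_neg (Real.log y - Real.log (x - 1)), ← zetaScrew_neg (Real.log (y - 1) - Real.log x),
    ← zetaScrew_neg (Real.log y - Real.log x), ← zetaScrew_neg (Real.log (y - 1) - Real.log (x - 1))]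
  simp only [neg_sub]
  ring

/-- The label bracket in quotient form, for labels `> 1`. [folklore] -/
theorem bracket_eq_quot {x y : ℝ} (hx : 1 < x) (hy : 1 < y) :
    zetaScrew (Real.log x - Real.log (y - 1)) + zetaScrew (Real.log (x - 1) - Real.log y)
      - zetaScrew (Real.log x - Real.log y) - zetaScrew (Real.log (x - 1) - Real.log (y - 1))
    = zetaScrew (Real.log (x / (y - 1))) + zetaScrew (Real.log ((x - 1) / y))
      - zetaScrew (Real.log (x / y)) - zetaScrew (Real.log ((x - 1) / (y - 1))) := by
  have hx0 : x ≠ 0 := by positivity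
  have hy0 : y ≠ 0 := by positivity
  have hx1 : x - 1 ≠ 0 := by linarith
  have hy1 : y - 1 ≠ 0 := by linarith
  rw [Real.log_div hx0 hy1, Real.log_div hx1 hy0, Real.log_div hx0 hy0, Real.log_div hx1 hy1]

/-- On the diagonal the label bracket is the increment variance `2Ψ(log x − log(x−1))`. [folklore] -/
theorem bracket_self (x : ℝ) :
    zetaScrew (Real.log x - Real.log (x - 1)) + zetaScrew (Real.log (x - 1) - Real.log x)
      - zetaScrew (Real.log x - Real.log x) - zetaScrew (Real.log (x - 1) - Real.log (x - 1))
    = 2 * zetaScrew (Real.log x - Real.log (x - 1)) := by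
  rw [sub_self, sub_self, zetaScrew_zero, ← zetaScrew_neg (Real.log (x - 1) - Real.log x), neg_sub]
  ring

/-! ### Label asymptotics -/

/-- Eventually (in `M : ℕ`) the real cast exceeds any given real. [folklore] -/
private theorem eventually_natCast_gt₃ (c : ℝ) : ∀ᶠ M : ℕ in atTop, c < (M : ℝ) :=
  tendsto_natCast_atTop_atTop.eventually (eventually_gt_atTop c)

/-- `(M − k)/M → 1`. [folklore] -/
theorem tendsto_natSub_div (k : ℕ) :
    Tendsto (fun M : ℕ => ((M - k : ℕ) : ℝ) / M) atTop (𝓝 1) := by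
  have h : Tendsto (fun M : ℕ => 1 - (k : ℝ) / M) atTop (𝓝 (1 - 0)) :=
    tendsto_const_nhds.sub (tendsto_const_nhds.div_atTop tendsto_natCast_atTop_atTop)
  rw [sub_zero] at h
  refine h.congr' ?_
  filter_upwards [eventually_ge_atTop (k + 1)] with M hM
  have hM0 : (0 : ℝ) < M := by exact_mod_cast (by omega : 0 < M)
  rw [Nat.cast_sub (by omega)]
  field_simp

/-- `n·⌈M/n⌉` is within `n − 1` of `M`: `M ≤ n·((M + n − 1)/n) ≤ M + n − 1` (`n ≥ 1`). [folklore] -/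
theorem le_mul_ceilDiv_and {n : ℕ} (hn : 1 ≤ n) (M : ℕ) :
    M ≤ n * ((M + n - 1) / n) ∧ n * ((M + n - 1) / n) ≤ M + n - 1 := by
  have h1 := Nat.div_add_mod (M + n - 1) n
  have h2 := Nat.mod_lt (M + n - 1) (by omega : 0 < n)
  constructor <;> omega

/-- `⌈M/n⌉/M → 1/n` (`n ≥ 1`). [folklore] -/
theorem tendsto_ceilDiv_div {n : ℕ} (hn : 1 ≤ n) :
    Tendsto (fun M : ℕ => ((((M + n - 1) / n : ℕ)) : ℝ) / M) atTop (𝓝 (1 / (n : ℝ))) := by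
  have hn0 : (0 : ℝ) < n := by exact_mod_cast (by omega : 0 < n)
  -- squeeze between 1/n and 1/n + 1/M
  have hlo : Tendsto (fun _ : ℕ => 1 / (n : ℝ)) atTop (𝓝 (1 / (n : ℝ))) := tendsto_const_nhds
  have hhi : Tendsto (fun M : ℕ => 1 / (n : ℝ) + 1 / (M : ℝ)) atTop (𝓝 (1 / (n : ℝ) + 0)) :=
    tendsto_const_nhds.add (tendsto_const_nhds.div_atTop tendsto_natCast_atTop_atTop)
  rw [add_zero] at hhi
  refine tendsto_of_tendsto_of_tendsto_of_le_of_le' hlo hhi ?_ ?_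
  · filter_upwards [eventually_ge_atTop 1] with M hM
    have hM0 : (0 : ℝ) < M := by exact_mod_cast (by omega : 0 < M)
    have h := (le_mul_ceilDiv_and hn M).1
    have h' : (M : ℝ) ≤ (n : ℝ) * (((M + n - 1) / n : ℕ) : ℝ) := by exact_mod_cast h
    rw [div_le_div_iff₀ hn0 hM0]
    linarith
  · filter_upwards [eventually_ge_atTop 1] with M hM
    have hM0 : (0 : ℝ) < M := by exact_mod_cast (by omega : 0 < M)
    have h := (le_mul_ceilDiv_and hn M).2
    have h' : (n : ℝ) * (((M + n - 1) / n : ℕ) : ℝ) ≤ (M : ℝ) + n - 1 := by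
      have : ((n * ((M + n - 1) / n) : ℕ) : ℝ) ≤ ((M + n - 1 : ℕ) : ℝ) := by exact_mod_cast h
      rw [Nat.cast_mul, Nat.cast_sub (by omega), Nat.cast_add, Nat.cast_one] at this
      exact this
    have e : 1 / (n : ℝ) + 1 / (M : ℝ) = ((M : ℝ) + n) / ((n : ℝ) * M) := by
      field_simp
    rw [e, div_le_div_iff₀ hM0 (by positivity)]
    nlinarith

/-- Eventually `⌈M/n⌉ ≥ 3`, `⌈M/n⌉ + 2 ≤ M` and `n·⌈M/n⌉ ≥ M` (`n ≥ 2`). [folklore] -/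
theorem eventually_ceilDiv_bounds {n : ℕ} (hn : 2 ≤ n) :
    ∀ᶠ M : ℕ in atTop, 3 ≤ (M + n - 1) / n ∧ (M + n - 1) / n + 2 ≤ M := by
  filter_upwards [eventually_ge_atTop (3 * n + 4)] with M hM
  have h := le_mul_ceilDiv_and (by omega : 1 ≤ n) M
  constructor
  · by_contra hc
    push Not at hc
    have : n * ((M + n - 1) / n) ≤ n * 2 := Nat.mul_le_mul_left _ (by omega)
    omega
  · have h2 : 2 * ((M + n - 1) / n) ≤ n * ((M + n - 1) / n) := Nat.mul_le_mul_right _ hn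
    omega

/-! ### Rows: the corner against a neighbour and against a carrier -/

/-- **Row, neighbour:** `M·B(M, M−k) → c_k/2 = −½Δ²[k log k]` for `k ≥ 1`
(`IntegerScrewIncrementCovLag.tendsto_incrementCovLag` in label form). [folklore] -/
theorem tendsto_cornerBracket_lag (k : ℕ) (hk : 1 ≤ k) :
    Tendsto (fun M : ℕ => (M : ℝ) *
        (zetaScrew (Real.log (M : ℝ) - Real.log (((M - k : ℕ) : ℝ) - 1))
          + zetaScrew (Real.log ((M : ℝ) - 1) - Real.log ((M - k : ℕ) : ℝ))
          - zetaScrew (Real.log (M : ℝ) - Real.log ((M - k : ℕ) : ℝ))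
          - zetaScrew (Real.log ((M : ℝ) - 1) - Real.log (((M - k : ℕ) : ℝ) - 1))))
      atTop
      (𝓝 (-(((k : ℝ) + 1) * Real.log ((k : ℝ) + 1) - 2 * ((k : ℝ) * Real.log k)
        + ((k : ℝ) - 1) * Real.log ((k : ℝ) - 1)) / 2)) := by
  refine (tendsto_incrementCovLag k hk).congr' ?_
  filter_upwards [eventually_ge_atTop (k + 2)] with M hM
  have hMr : ((k : ℝ) + 2) ≤ (M : ℝ) := by exact_mod_cast hM
  have hcast : ((M - k : ℕ) : ℝ) = (M : ℝ) - k := by rw [Nat.cast_sub (by omega)]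
  have h0 : (M : ℝ) ≠ 0 := (by linarith : (0 : ℝ) < M).ne'
  have h1 : (M : ℝ) - 1 ≠ 0 := (by linarith : (0 : ℝ) < (M : ℝ) - 1).ne'
  have hk0 : (M : ℝ) - k ≠ 0 := (by linarith : (0 : ℝ) < (M : ℝ) - k).ne'
  have hk1 : (M : ℝ) - (k + 1) ≠ 0 := (by linarith : (0 : ℝ) < (M : ℝ) - (k + 1)).ne'
  rw [hcast, show (M : ℝ) - k - 1 = (M : ℝ) - (k + 1) by ring,
    Real.log_div h0 hk1, Real.log_div h1 hk0, Real.log_div h0 hk0, Real.log_div h1 hk1]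

/-- **Row, carrier:** `M·B(M, ⌈M/n⌉) → −Λ(n)/√n` for `n ≥ 2`
(`IntegerScrewHingeBrackets.tendsto_hingeCov_ceil` in label form). [folklore] -/
theorem tendsto_cornerBracket_ceil {n : ℕ} (hn : 2 ≤ n) :
    Tendsto (fun M : ℕ => (M : ℝ) *
        (zetaScrew (Real.log (M : ℝ) - Real.log ((((M + n - 1) / n : ℕ) : ℝ) - 1))
          + zetaScrew (Real.log ((M : ℝ) - 1) - Real.log (((M + n - 1) / n : ℕ) : ℝ))
          - zetaScrew (Real.log (M : ℝ) - Real.log (((M + n - 1) / n : ℕ) : ℝ))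
          - zetaScrew (Real.log ((M : ℝ) - 1) - Real.log ((((M + n - 1) / n : ℕ) : ℝ) - 1))))
      atTop (𝓝 (-(ArithmeticFunction.vonMangoldt n / Real.sqrt n))) := by
  refine (tendsto_hingeCov_ceil hn).congr' ?_
  filter_upwards [eventually_ceilDiv_bounds hn] with M hM
  have hc3 : (3 : ℝ) ≤ (((M + n - 1) / n : ℕ) : ℝ) := by exact_mod_cast hM.1
  have hM5 : (5 : ℝ) ≤ (M : ℝ) := by exact_mod_cast (by omega : 5 ≤ M)
  rw [bracket_eq_quot (by linarith) (by linarith)]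

/-! ### Diagonals -/

/-- **Diagonal, neighbour:** `M·B(M−k, M−k)/log M → 1`
(`IntegerScrewIncrementCovLag.tendsto_incrementEnergy_shift_div_log`). [folklore] -/
theorem tendsto_lagBracket_self_div_log (k : ℕ) :
    Tendsto (fun M : ℕ => (M : ℝ) *
        (zetaScrew (Real.log ((M - k : ℕ) : ℝ) - Real.log (((M - k : ℕ) : ℝ) - 1))
          + zetaScrew (Real.log (((M - k : ℕ) : ℝ) - 1) - Real.log ((M - k : ℕ) : ℝ))
          - zetaScrew (Real.log ((M - k : ℕ) : ℝ) - Real.log ((M - k : ℕ) : ℝ))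
          - zetaScrew (Real.log (((M - k : ℕ) : ℝ) - 1) - Real.log (((M - k : ℕ) : ℝ) - 1)))
        / Real.log (M : ℝ)) atTop (𝓝 1) := by
  refine (tendsto_incrementEnergy_shift_div_log k).congr' ?_
  filter_upwards [eventually_ge_atTop (k + 2)] with M hM
  have hMr : ((k : ℝ) + 2) ≤ (M : ℝ) := by exact_mod_cast hM
  have hcast : ((M - k : ℕ) : ℝ) = (M : ℝ) - k := by rw [Nat.cast_sub (by omega)]
  have hk0 : (M : ℝ) - k ≠ 0 := (by linarith : (0 : ℝ) < (M : ℝ) - k).ne'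
  have hk1 : (M : ℝ) - k - 1 ≠ 0 := (by linarith : (0 : ℝ) < (M : ℝ) - k - 1).ne'
  rw [bracket_self, hcast, Real.log_div hk0 hk1]

/-- **Diagonal, carrier:** `M·B(⌈M/n⌉, ⌈M/n⌉)/log M → n` for `n ≥ 2`
(`IntegerScrewHingeBrackets.tendsto_hingeEnergy_div_log`). [folklore] -/
theorem tendsto_ceilBracket_self_div_log {n : ℕ} (hn : 2 ≤ n) :
    Tendsto (fun M : ℕ => (M : ℝ) *
        (zetaScrew (Real.log (((M + n - 1) / n : ℕ) : ℝ) - Real.log ((((M + n - 1) / n : ℕ) : ℝ) - 1))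
          + zetaScrew (Real.log ((((M + n - 1) / n : ℕ) : ℝ) - 1) - Real.log (((M + n - 1) / n : ℕ) : ℝ))
          - zetaScrew (Real.log (((M + n - 1) / n : ℕ) : ℝ) - Real.log (((M + n - 1) / n : ℕ) : ℝ))
          - zetaScrew (Real.log ((((M + n - 1) / n : ℕ) : ℝ) - 1)
              - Real.log ((((M + n - 1) / n : ℕ) : ℝ) - 1)))
        / Real.log (M : ℝ)) atTop (𝓝 (n : ℝ)) := by
  refine (tendsto_hingeEnergy_div_log hn).congr' ?_
  filter_upwards [eventually_ceilDiv_bounds hn] with M hM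
  have hc3 : (3 : ℝ) ≤ (((M + n - 1) / n : ℕ) : ℝ) := by exact_mod_cast hM.1
  have hc0 : (((M + n - 1) / n : ℕ) : ℝ) ≠ 0 := (by linarith : (0 : ℝ) < (((M + n - 1) / n : ℕ) : ℝ)).ne'
  have hc1 : (((M + n - 1) / n : ℕ) : ℝ) - 1 ≠ 0 :=
    (by linarith : (0 : ℝ) < (((M + n - 1) / n : ℕ) : ℝ) - 1).ne'
  rw [bracket_self, Real.log_div hc0 hc1]

/-! ### Cross terms: eventually bounded -/

/-- A convergent real sequence is eventually bounded in absolute value. [folklore] -/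
theorem exists_eventually_abs_le_of_tendsto {f : ℕ → ℝ} {c : ℝ} (h : Tendsto f atTop (𝓝 c)) :
    ∃ B : ℝ, ∀ᶠ M in atTop, |f M| ≤ B := by
  refine ⟨|c| + 1, ?_⟩
  filter_upwards [h.eventually (Metric.ball_mem_nhds c one_pos)] with M hM
  rw [Real.dist_eq] at hM
  have := abs_sub_abs_le_abs_sub (f M) c
  linarith

/-- **Two neighbours:** for `1 ≤ j`, `1 ≤ k`, `j ≠ k`, `M·B(M−j, M−k)` is eventually bounded (it converges
to `c_{|k−j|}/2`, `IntegerScrewIncrementBrackets.tendsto_mul_incrementBracket`). [folklore] -/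
theorem eventually_abs_lagBracket_le {j k : ℕ} (hjk : j ≠ k) :
    ∃ B : ℝ, ∀ᶠ M : ℕ in atTop, |(M : ℝ) *
        (zetaScrew (Real.log ((M - j : ℕ) : ℝ) - Real.log (((M - k : ℕ) : ℝ) - 1))
          + zetaScrew (Real.log (((M - j : ℕ) : ℝ) - 1) - Real.log ((M - k : ℕ) : ℝ))
          - zetaScrew (Real.log ((M - j : ℕ) : ℝ) - Real.log ((M - k : ℕ) : ℝ))
          - zetaScrew (Real.log (((M - j : ℕ) : ℝ) - 1) - Real.log (((M - k : ℕ) : ℝ) - 1)))| ≤ B := by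
  -- the bracket in the `(M:ℝ) − j` form of `IntegerScrewIncrementBrackets`, for either order of j, k
  have key : ∀ {j k : ℕ}, j < k → ∃ B : ℝ, ∀ᶠ M : ℕ in atTop, |(M : ℝ) *
        (zetaScrew (Real.log ((M - j : ℕ) : ℝ) - Real.log (((M - k : ℕ) : ℝ) - 1))
          + zetaScrew (Real.log (((M - j : ℕ) : ℝ) - 1) - Real.log ((M - k : ℕ) : ℝ))
          - zetaScrew (Real.log ((M - j : ℕ) : ℝ) - Real.log ((M - k : ℕ) : ℝ))
          - zetaScrew (Real.log (((M - j : ℕ) : ℝ) - 1) - Real.log (((M - k : ℕ) : ℝ) - 1)))| ≤ B := by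
    intro j k hlt
    obtain ⟨B, hB⟩ := exists_eventually_abs_le_of_tendsto (tendsto_mul_incrementBracket hlt)
    refine ⟨B, ?_⟩
    filter_upwards [hB, eventually_ge_atTop (k + 1)] with M hM hMk
    have hj : ((M - j : ℕ) : ℝ) = (M : ℝ) - j := by rw [Nat.cast_sub (by omega)]
    have hk : ((M - k : ℕ) : ℝ) = (M : ℝ) - k := by rw [Nat.cast_sub (by omega)]
    rw [hj, hk, show (M : ℝ) - j - 1 = (M : ℝ) - ((j : ℝ) + 1) by ring,
      show (M : ℝ) - k - 1 = (M : ℝ) - ((k : ℝ) + 1) by ring]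
    exact hM
  rcases lt_or_gt_of_ne hjk with h | h
  · exact key h
  · obtain ⟨B, hB⟩ := key h
    refine ⟨B, ?_⟩
    filter_upwards [hB] with M hM
    rw [bracket_symm]
    exact hM

/-- **Neighbour against carrier:** for every `k` and `n ≥ 2`, `M·B(M−k, ⌈M/n⌉)` is eventually bounded
(`IntegerScrewFarBrackets.eventually_abs_mul_farBracket_le` with `α = 1`, `β = 1/n`). [folklore] -/
theorem eventually_abs_lagCeilBracket_le (k : ℕ) {n : ℕ} (hn : 2 ≤ n) :
    ∃ B : ℝ, ∀ᶠ M : ℕ in atTop, |(M : ℝ) *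
        (zetaScrew (Real.log ((M - k : ℕ) : ℝ) - Real.log ((((M + n - 1) / n : ℕ) : ℝ) - 1))
          + zetaScrew (Real.log (((M - k : ℕ) : ℝ) - 1) - Real.log (((M + n - 1) / n : ℕ) : ℝ))
          - zetaScrew (Real.log ((M - k : ℕ) : ℝ) - Real.log (((M + n - 1) / n : ℕ) : ℝ))
          - zetaScrew (Real.log (((M - k : ℕ) : ℝ) - 1) - Real.log ((((M + n - 1) / n : ℕ) : ℝ) - 1)))|
      ≤ B := by
  have hn0 : (0 : ℝ) < n := by exact_mod_cast (by omega : 0 < n)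
  have hβ : (0 : ℝ) < 1 / (n : ℝ) := by positivity
  have hαβ : 1 / (n : ℝ) < 1 := by
    rw [div_lt_one hn0]; exact_mod_cast (by omega : 1 < n)
  obtain ⟨C, hC⟩ := eventually_abs_mul_farBracket_le (fun M => M - k) (fun M => (M + n - 1) / n)
    hβ hαβ (tendsto_natSub_div k) (tendsto_ceilDiv_div (by omega : 1 ≤ n))
  refine ⟨C, ?_⟩
  filter_upwards [hC, eventually_ceilDiv_bounds hn, eventually_ge_atTop (k + 2)] with M hM hc hMk
  have hc3 : (3 : ℝ) ≤ (((M + n - 1) / n : ℕ) : ℝ) := by exact_mod_cast hc.1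
  have ha : (2 : ℝ) ≤ ((M - k : ℕ) : ℝ) := by exact_mod_cast (by omega : 2 ≤ M - k)
  rw [bracket_eq_quot (by linarith) (by linarith)]
  exact hM

/-- **Two carriers:** for `2 ≤ n`, `2 ≤ n'`, `n ≠ n'`, `M·B(⌈M/n⌉, ⌈M/n'⌉)` is eventually bounded
(`IntegerScrewFarBrackets.eventually_abs_mul_farBracket_le` with `α = 1/min`, `β = 1/max`, and the
symmetry of the bracket). [folklore] -/
theorem eventually_abs_ceilCeilBracket_le {n n' : ℕ} (hn : 2 ≤ n) (hn' : 2 ≤ n') (hne : n ≠ n') :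
    ∃ B : ℝ, ∀ᶠ M : ℕ in atTop, |(M : ℝ) *
        (zetaScrew (Real.log (((M + n - 1) / n : ℕ) : ℝ) - Real.log ((((M + n' - 1) / n' : ℕ) : ℝ) - 1))
          + zetaScrew (Real.log ((((M + n - 1) / n : ℕ) : ℝ) - 1) - Real.log (((M + n' - 1) / n' : ℕ) : ℝ))
          - zetaScrew (Real.log (((M + n - 1) / n : ℕ) : ℝ) - Real.log (((M + n' - 1) / n' : ℕ) : ℝ))
          - zetaScrew (Real.log ((((M + n - 1) / n : ℕ) : ℝ) - 1)
              - Real.log ((((M + n' - 1) / n' : ℕ) : ℝ) - 1)))| ≤ B := by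
  -- the case n < n' (carrier of n is the LARGER label), then symmetry
  have key : ∀ {n n' : ℕ}, 2 ≤ n → 2 ≤ n' → n < n' → ∃ B : ℝ, ∀ᶠ M : ℕ in atTop, |(M : ℝ) *
        (zetaScrew (Real.log (((M + n - 1) / n : ℕ) : ℝ) - Real.log ((((M + n' - 1) / n' : ℕ) : ℝ) - 1))
          + zetaScrew (Real.log ((((M + n - 1) / n : ℕ) : ℝ) - 1) - Real.log (((M + n' - 1) / n' : ℕ) : ℝ))
          - zetaScrew (Real.log (((M + n - 1) / n : ℕ) : ℝ) - Real.log (((M + n' - 1) / n' : ℕ) : ℝ))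
          - zetaScrew (Real.log ((((M + n - 1) / n : ℕ) : ℝ) - 1)
              - Real.log ((((M + n' - 1) / n' : ℕ) : ℝ) - 1)))| ≤ B := by
    intro n n' hn hn' hlt
    have hn0 : (0 : ℝ) < n := by exact_mod_cast (by omega : 0 < n)
    have hn0' : (0 : ℝ) < n' := by exact_mod_cast (by omega : 0 < n')
    have hβ : (0 : ℝ) < 1 / (n' : ℝ) := by positivity
    have hαβ : 1 / (n' : ℝ) < 1 / (n : ℝ) := by
      rw [div_lt_div_iff₀ hn0' hn0, one_mul, one_mul]; exact_mod_cast hlt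
    obtain ⟨C, hC⟩ := eventually_abs_mul_farBracket_le (fun M => (M + n - 1) / n)
      (fun M => (M + n' - 1) / n') hβ hαβ (tendsto_ceilDiv_div (by omega : 1 ≤ n))
      (tendsto_ceilDiv_div (by omega : 1 ≤ n'))
    refine ⟨C, ?_⟩
    filter_upwards [hC, eventually_ceilDiv_bounds hn, eventually_ceilDiv_bounds hn'] with M hM hc hc'
    have hc3 : (3 : ℝ) ≤ (((M + n - 1) / n : ℕ) : ℝ) := by exact_mod_cast hc.1
    have hc3' : (3 : ℝ) ≤ (((M + n' - 1) / n' : ℕ) : ℝ) := by exact_mod_cast hc'.1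
    rw [bracket_eq_quot (by linarith) (by linarith)]
    exact hM
  rcases lt_or_gt_of_ne hne with h | h
  · exact key hn hn' h
  · obtain ⟨B, hB⟩ := key hn' hn h
    refine ⟨B, ?_⟩
    filter_upwards [hB] with M hM
    rw [bracket_symm]
    exact hM

end Summit.RiemannHypothesis.RiemannHypothesis.Theorems.IntegerScrew

end
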